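import Summits.QuantumFields.GaugeBoot.ZdCentralTwistSymmetries
import Summits.QuantumFields.GaugeBoot.ClassBNegativeCouplingAllReps
import Summits.QuantumFields.GaugeBoot.ClassBLimitLinkGeometry
import HarnessLib

/-!
# Invariances and reflection positivity of twisted states; the twist of a Class-B state
# (gauge-boot, L3 structural supplement; `ℤ^d` twist 3/4)

HONEST FRAMING (cell `pub-gaugeboot`, page 1 of every file): the venture produces certified bounds
on lattice expectations at stated coupling, gauge group, dimension and torus size; NOT a mass gap,
NOT a continuum limit, NOT a string tension; NOT Yang–Mills-summit-bearing (barriers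
`FixedCouplingUltralocality`, `PerturbativeInvisibility`). This module bounds no expectation; no
certificate of the cell sits at `β < 0`.

Parts 1–2 (`ZdCentralTwist.lean`, `ZdCentralTwistSymmetries.lean`): the Kogut–Susskind twist
`T = centralTwist (stagTwist π r z)` on `ℤ^d` (`ρ z = -1`) maps one-link Gibbs states at `β` to
one-link Gibbs states at `-β`, and commutes with translations, axis permutations, site and link
reflections and diagonal swaps UP TO `ℤ/2` GAUGE TRANSFORMATIONS (exactly, for site reflections
and for the link reflection of the last axis). Consequences for STATES (measures on
`LGConfig d G`):

* `measurePreserving_map_centralTwist_of_conj` (general principle: `Θ ∘ T = g ∘ T ∘ Θ`, `μ`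
  `Θ`-invariant and gauge invariant ⇒ `μ ∘ T⁻¹` is `Θ`-invariant); `reflectInvariant_map_centralTwist`,
  `permInvariant_map_centralTwist`; `map_centralTwist_stagTwist_eq_of_last` (for gauge-invariant
  states the twisted state does not depend on the last axis `r`);
* ★★ REFLECTION POSITIVITY OF TWISTED STATES: `isReflectionPositiveFor_map_centralTwist_of_conj`
  (general principle: if `Θ ∘ T = g ∘ T ∘ Θ` and `μ` is RP for `Θ` on the half `S`, then the twisted
  state satisfies `0 ≤ ∫ (F∘Θ)‾ F` for every half observable `F` with `F ∘ g = F` — because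
  `∫ (F∘Θ)‾ F d(μ∘T⁻¹) = ∫ ((F∘T)∘Θ)‾ (F∘T) dμ` and `T` preserves supports); hence
  ★★ `siteRP_map_centralTwist` (site mirrors: ALL half observables, every axis),
  `linkRP_map_centralTwist_last` (link mirror of the last axis: all half observables),
  ★★ `linkRP_map_centralTwist_of_gaugeInvariant`, ★★ `diagRP_map_centralTwist_of_gaugeInvariant`
  (every link / diagonal mirror: all GAUGE-INVARIANT half observables);
* ★★★ `ClassBState.twist_summary` — for a Class-B state `ω` at `β` whose measure is gauge invariant
  and `ρ z = -1` (`SU(2)`, `SU(2n)`, `U(N)` fundamental): the twisted state at `-β` is a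
  translation-, permutation- and reflection-invariant one-link Gibbs state at `-β`, site-RP in every
  axis, link-RP along `r`, link-RP and diagonal-RP on all gauge-invariant half observables — i.e.
  it satisfies EVERY constraint a Wilson-loop (gauge-invariant) bootstrap at `-β` consumes;
  ★★★ `ClassBState.exists_not_diagRP_twist` — yet for `β > 0`, `d ≥ 2` and non-trivial `ρ` it
  VIOLATES full diagonal RP in some plane (`ClassBNegativeCouplingAllReps`: no translation-invariant
  one-link Gibbs state at negative coupling is diagonally RP in all planes). So the Class-B
  obstruction at `β < 0` (`isEmpty_classBState_of_neg_of_ne_one`) is carried exactly by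
  gauge-VARIANT diagonal half observables; `exists_isDualParity_zdUnit` (the parities exist).

What is NOT claimed: no Class-B state at `β < 0` (there is none for non-trivial `ρ`); nothing for
`SU(2n+1)` (no central involution with `ρ z = -1`); nothing about torus limit points (part 4).
Structural; NOT a bound on any expectation. [folklore] bookkeeping (Li–Meurice 2005 §II;
Osterwalder–Seiler, Ann. Phys. 110 (1978) §2; Georgii 2011 Ch. 5).
-/

noncomputable section

open MeasureTheory
open scoped ComplexOrder
open Literature.Probability.LatticeModels (Site)
open Literature.MathematicalPhysics.QuantumLattice

namespace Summit.QuantumFields.GaugeBoot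

namespace TiltedRP

variable {d N : ℕ} {G : Type*} [Group G]

/-! ## Invariances and reflection positivity of twisted states -/

section States

variable [TopologicalSpace G] [IsTopologicalGroup G] [MeasurableSpace G] [BorelSpace G]
  {z : G} {π : Fin d → Site d →+ ZMod 2}

/-- General principle: if `Θ ∘ T_s = g ∘ T_s ∘ Θ` for a gauge transformation `g`, `μ` is
`Θ`-invariant and gauge invariant, then the twisted state `μ ∘ T_s⁻¹` is `Θ`-invariant. -/
theorem measurePreserving_map_centralTwist_of_conj {s : ZdEdge d → G}
    (hcomm : ∀ l g, s l * g = g * s l) {Θ : LGConfig d G → LGConfig d G} (hΘ : Measurable Θ)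
    {k : Site d → G} (hconj : ∀ U, Θ (centralTwist s U) = gaugeTransformZd k (centralTwist s (Θ U)))
    {μ : Measure (LGConfig d G)} (hμΘ : MeasurePreserving Θ μ μ)
    (hμG : ∀ k : Site d → G, μ.map (gaugeTransformZd k) = μ) :
    MeasurePreserving Θ (μ.map (centralTwist s)) (μ.map (centralTwist s)) := by
  have hT := measurable_centralTwist (d := d) (A := Site d) (G := G) s
  refine ⟨hΘ, ?_⟩
  calc (μ.map (centralTwist s)).map Θ = μ.map (Θ ∘ centralTwist s) := Measure.map_map hΘ hT
    _ = μ.map ((gaugeTransformZd k ∘ centralTwist s) ∘ Θ) := by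
        congr 1; funext U; exact hconj U
    _ = (μ.map Θ).map (gaugeTransformZd k ∘ centralTwist s) :=
        (Measure.map_map ((measurable_gaugeTransformZd k).comp hT) hΘ).symm
    _ = μ.map (gaugeTransformZd k ∘ centralTwist s) := by rw [hμΘ.map_eq]
    _ = (μ.map (centralTwist s)).map (gaugeTransformZd k) :=
        (Measure.map_map (measurable_gaugeTransformZd k) hT).symm
    _ = μ.map (centralTwist s) := map_gaugeTransformZd_map_centralTwist hcomm hμG k

variable [SecondCountableTopology G]

/-- **The twisted state of a reflection-invariant gauge-invariant state is reflection invariant**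
(site reflections commute with the twist exactly). -/
theorem reflectInvariant_map_centralTwist (hπ : IsDualParity (zdUnit d) π)
    (hzc : ∀ g : G, z * g = g * z) (hz2 : z * z = 1) (r : Fin d) {μ : Measure (LGConfig d G)}
    (hμR : ∀ i : Fin d, MeasurePreserving (configSiteReflect i) μ μ)
    (hμG : ∀ k : Site d → G, μ.map (gaugeTransformZd k) = μ) (i : Fin d) :
    MeasurePreserving (configSiteReflect i) (μ.map (centralTwist (stagTwist π r z)))
      (μ.map (centralTwist (stagTwist π r z))) := by
  have hcomm : ∀ (l : ZdEdge d) (g : G), stagTwist π r z l * g = g * stagTwist π r z l :=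
    fun l g => by unfold stagTwist zpow₂; split_ifs <;> simp [hzc]
  refine measurePreserving_map_centralTwist_of_conj hcomm (measurable_configSiteReflect i)
    (k := fun _ => 1) (fun U => ?_) (hμR i) hμG
  rw [configSiteReflect_centralTwist_stagTwist hπ hzc hz2 r i U]
  funext e; simp [gaugeTransformZd]

omit [SecondCountableTopology G] in
/-- **The twisted state of a permutation-invariant gauge-invariant state is permutation invariant.** -/
theorem permInvariant_map_centralTwist (hπ : IsDualParity (zdUnit d) π)
    (hzc : ∀ g : G, z * g = g * z) (hz2 : z * z = 1) (r : Fin d) {μ : Measure (LGConfig d G)}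
    (hμP : ∀ σ : Equiv.Perm (Fin d), MeasurePreserving (configPerm σ) μ μ)
    (hμG : ∀ k : Site d → G, μ.map (gaugeTransformZd k) = μ) (σ : Equiv.Perm (Fin d)) :
    MeasurePreserving (configPerm σ) (μ.map (centralTwist (stagTwist π r z)))
      (μ.map (centralTwist (stagTwist π r z))) := by
  have hcomm : ∀ (l : ZdEdge d) (g : G), stagTwist π r z l * g = g * stagTwist π r z l :=
    fun l g => by unfold stagTwist zpow₂; split_ifs <;> simp [hzc]
  exact measurePreserving_map_centralTwist_of_conj hcomm (measurable_pi_lambda _ fun _ => measurable_pi_apply _)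
    (fun U => configPerm_centralTwist_stagTwist hπ hzc hz2 r σ U) (hμP σ) hμG

omit [SecondCountableTopology G] in
/-- **For a gauge-invariant state the twisted state does not depend on the choice of the last axis.** -/
theorem map_centralTwist_stagTwist_eq_of_last (hπ : IsDualParity (zdUnit d) π)
    (hzc : ∀ g : G, z * g = g * z) (hz2 : z * z = 1) (r r' : Fin d) {μ : Measure (LGConfig d G)}
    (hμG : ∀ k : Site d → G, μ.map (gaugeTransformZd k) = μ) :
    μ.map (centralTwist (stagTwist π r' z)) = μ.map (centralTwist (stagTwist π r z)) := by
  have hcomm : ∀ (l : ZdEdge d) (g : G), stagTwist π r z l * g = g * stagTwist π r z l :=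
    fun l g => by unfold stagTwist zpow₂; split_ifs <;> simp [hzc]
  obtain ⟨k, hk⟩ := centralTwist_stagTwist_eq_gauge_of_last (G := G) hπ hzc hz2 r r'
  have hT := measurable_centralTwist (d := d) (A := Site d) (G := G) (stagTwist π r z)
  rw [show (centralTwist (stagTwist π r' z) : LGConfig d G → LGConfig d G) =
      gaugeTransformZd k ∘ centralTwist (stagTwist π r z) from funext hk,
    ← Measure.map_map (measurable_gaugeTransformZd k) hT]
  exact map_gaugeTransformZd_map_centralTwist hcomm hμG k

omit [SecondCountableTopology G] in
/-- ★★ **Reflection positivity of twisted states** (general principle). If `Θ ∘ T_s = g ∘ T_s ∘ Θ`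
for a gauge transformation `g`, and `μ` is reflection positive for `Θ` on the half `S`, then the
twisted state `μ ∘ T_s⁻¹` satisfies `0 ≤ ∫ (F∘Θ)‾ F` for every bounded measurable observable `F` of the
half `S` with `F ∘ g = F`: indeed `∫ (F∘Θ)‾ F d(μ∘T⁻¹) = ∫ ((F∘T)∘Θ)‾ (F∘T) dμ`. -/
theorem isReflectionPositiveFor_map_centralTwist_of_conj {s : ZdEdge d → G}
    {Θ : LGConfig d G → LGConfig d G} (hΘ : Measurable Θ) {k : Site d → G}
    (hconj : ∀ U, Θ (centralTwist s U) = gaugeTransformZd k (centralTwist s (Θ U)))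
    {S : Set (ZdEdge d)} {μ : Measure (LGConfig d G)} (hRP : IsReflectionPositiveFor Θ S μ)
    {F : LGConfig d G → ℂ} (hFm : Measurable F) (hFb : ∃ C : ℝ, ∀ U, ‖F U‖ ≤ C)
    (hFS : DependsOn F S) (hFk : ∀ U, F (gaugeTransformZd k U) = F U) :
    0 ≤ ∫ U, (starRingEnd ℂ) (F (Θ U)) * F U ∂(μ.map (centralTwist s)) := by
  have hT := measurable_centralTwist (d := d) (A := Site d) (G := G) s
  rw [integral_map_centralTwist_of_measurable s μ (F := fun U => (starRingEnd ℂ) (F (Θ U)) * F U)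
    ((Complex.continuous_conj.measurable.comp (hFm.comp hΘ)).mul hFm)]
  have h := hRP (F ∘ centralTwist s) (hFm.comp hT) (hFb.imp fun C hC U => hC _)
    (dependsOn_comp_centralTwist s hFS)
  refine h.trans_eq (integral_congr_ae (ae_of_all _ fun U => ?_))
  simp only [Function.comp_apply, hconj U, hFk]

/-- ★★ **Site-mirror reflection positivity passes to the twisted state for ALL half observables**
(the site reflections commute with the twist), every axis, any half `S`. -/
theorem siteRP_map_centralTwist (hπ : IsDualParity (zdUnit d) π) (hzc : ∀ g : G, z * g = g * z)
    (hz2 : z * z = 1) (r i : Fin d) {S : Set (ZdEdge d)} {μ : Measure (LGConfig d G)}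
    (hRP : IsReflectionPositiveFor (configSiteReflect i) S μ) :
    IsReflectionPositiveFor (configSiteReflect i) S (μ.map (centralTwist (stagTwist π r z))) := by
  intro F hFm hFb hFS
  refine isReflectionPositiveFor_map_centralTwist_of_conj (measurable_configSiteReflect i)
    (k := fun _ => 1) (fun U => ?_) hRP hFm hFb hFS (fun U => ?_)
  · rw [configSiteReflect_centralTwist_stagTwist hπ hzc hz2 r i U]
    funext e; simp [gaugeTransformZd]
  · congr 1; funext e; simp [gaugeTransformZd]

/-- **Link-mirror reflection positivity along the LAST axis passes to the twisted state for all
half observables.** -/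
theorem linkRP_map_centralTwist_last (hπ : IsDualParity (zdUnit d) π) (hzc : ∀ g : G, z * g = g * z)
    (hz2 : z * z = 1) (r : Fin d) {S : Set (ZdEdge d)} {μ : Measure (LGConfig d G)}
    (hRP : IsReflectionPositiveFor (configLinkReflect r) S μ) :
    IsReflectionPositiveFor (configLinkReflect r) S (μ.map (centralTwist (stagTwist π r z))) := by
  intro F hFm hFb hFS
  refine isReflectionPositiveFor_map_centralTwist_of_conj (measurable_configLinkReflect r)
    (k := fun _ => 1) (fun U => ?_) hRP hFm hFb hFS (fun U => ?_)
  · rw [configLinkReflect_centralTwist_stagTwist_last hπ hzc hz2 r U]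
    funext e; simp [gaugeTransformZd]
  · congr 1; funext e; simp [gaugeTransformZd]

/-- ★★ **Link-mirror reflection positivity passes to the twisted state for gauge-invariant half
observables**, every axis. -/
theorem linkRP_map_centralTwist_of_gaugeInvariant (hπ : IsDualParity (zdUnit d) π)
    (hzc : ∀ g : G, z * g = g * z) (hz2 : z * z = 1) (r i : Fin d) {S : Set (ZdEdge d)}
    {μ : Measure (LGConfig d G)} (hRP : IsReflectionPositiveFor (configLinkReflect i) S μ)
    {F : LGConfig d G → ℂ} (hFm : Measurable F) (hFb : ∃ C : ℝ, ∀ U, ‖F U‖ ≤ C)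
    (hFS : DependsOn F S) (hFG : IsZdGaugeInvariant F) :
    0 ≤ ∫ U, (starRingEnd ℂ) (F (configLinkReflect i U)) * F U
      ∂(μ.map (centralTwist (stagTwist π r z))) :=
  isReflectionPositiveFor_map_centralTwist_of_conj (measurable_configLinkReflect i)
    (fun U => configLinkReflect_centralTwist_stagTwist hπ hzc hz2 r i U) hRP hFm hFb hFS
    (fun U => hFG _ U)

omit [SecondCountableTopology G] in
/-- ★★ **Diagonal-mirror reflection positivity passes to the twisted state for gauge-invariant half
observables**, every pair of axes. -/
theorem diagRP_map_centralTwist_of_gaugeInvariant (hπ : IsDualParity (zdUnit d) π)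
    (hzc : ∀ g : G, z * g = g * z) (hz2 : z * z = 1) (r i j : Fin d) {S : Set (ZdEdge d)}
    {μ : Measure (LGConfig d G)} (hRP : IsReflectionPositiveFor (configDiagSwapZd i j) S μ)
    {F : LGConfig d G → ℂ} (hFm : Measurable F) (hFb : ∃ C : ℝ, ∀ U, ‖F U‖ ≤ C)
    (hFS : DependsOn F S) (hFG : IsZdGaugeInvariant F) :
    0 ≤ ∫ U, (starRingEnd ℂ) (F (configDiagSwapZd i j U)) * F U
      ∂(μ.map (centralTwist (stagTwist π r z))) := by
  obtain ⟨k, hk⟩ := configDiagSwapZd_centralTwist_stagTwist (G := G) hπ hzc hz2 r i j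
  exact isReflectionPositiveFor_map_centralTwist_of_conj (measurable_pi_lambda _ fun _ => measurable_pi_apply _) hk hRP hFm hFb
    hFS (fun U => hFG _ U)

end States

/-! ## The twist of a Class-B state -/

section ClassB

variable [TopologicalSpace G] [IsTopologicalGroup G] [CompactSpace G] [MeasurableSpace G]
  [BorelSpace G] [SecondCountableTopology G]
variable (ρ : G →* Matrix (Fin N) (Fin N) ℂ) {z : G} {π : Fin d → Site d →+ ZMod 2}

omit [CompactSpace G] in
/-- ★★★ **The twist of a Class-B state.** Let `ω` be a Class-B state at coupling `β` whose measure
is gauge invariant, `ρ` continuous with `ρ z = -1` (`z` central, `z² = 1`), `π` the coordinate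
parities of `ℤ^d`, `r` any axis, `ν = ω.μ ∘ T⁻¹` the twisted state. Then `ν` is a probability
measure, translation invariant, invariant under axis permutations and reflections, a one-link
Gibbs (Haar-shift) state at `-β`, reflection positive for EVERY site mirror on all half
observables, for the link mirror of the axis `r` on all half observables, and for every link and
diagonal mirror on all gauge-invariant half observables. -/
theorem _root_.Summit.QuantumFields.GaugeBoot.ClassBState.twist_summary
    (hπ : IsDualParity (zdUnit d) π) (hzc : ∀ g : G, z * g = g * z) (hz2 : z * z = 1)
    (hρ : Continuous ρ) (hρz : ρ z = -1) (r : Fin d) {β : ℝ} (ω : ClassBState d ρ β)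
    (hωG : ∀ k : Site d → G, ω.μ.map (gaugeTransformZd k) = ω.μ) :
    IsProbabilityMeasure (ω.μ.map (centralTwist (stagTwist π r z))) ∧
    IsZdTranslationInvariant (ω.μ.map (centralTwist (stagTwist π r z))) ∧
    (∀ σ : Equiv.Perm (Fin d), MeasurePreserving (configPerm σ)
      (ω.μ.map (centralTwist (stagTwist π r z))) (ω.μ.map (centralTwist (stagTwist π r z)))) ∧
    (∀ i : Fin d, MeasurePreserving (configSiteReflect i)
      (ω.μ.map (centralTwist (stagTwist π r z))) (ω.μ.map (centralTwist (stagTwist π r z)))) ∧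
    IsHaarShiftState ρ (-β) (ω.μ.map (centralTwist (stagTwist π r z))) ∧
    (∀ i : Fin d, IsReflectionPositiveFor (configSiteReflect i) (siteHalfEdges i)
      (ω.μ.map (centralTwist (stagTwist π r z)))) ∧
    IsReflectionPositiveFor (configLinkReflect r) (linkHalfEdges r)
      (ω.μ.map (centralTwist (stagTwist π r z))) ∧
    (∀ (i : Fin d) (F : LGConfig d G → ℂ), Measurable F → (∃ C : ℝ, ∀ U, ‖F U‖ ≤ C) →
      DependsOn F (linkHalfEdges i) → IsZdGaugeInvariant F →
        0 ≤ ∫ U, (starRingEnd ℂ) (F (configLinkReflect i U)) * F U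
          ∂(ω.μ.map (centralTwist (stagTwist π r z)))) ∧
    (∀ (i j : Fin d), i ≠ j → ∀ F : LGConfig d G → ℂ, Measurable F → (∃ C : ℝ, ∀ U, ‖F U‖ ≤ C) →
      DependsOn F (diagHalfEdges i j) → IsZdGaugeInvariant F →
        0 ≤ ∫ U, (starRingEnd ℂ) (F (configDiagSwapZd i j U)) * F U
          ∂(ω.μ.map (centralTwist (stagTwist π r z)))) := by
  haveI := ω.isProbabilityMeasure
  have hs := isStaggering_stagTwist (e := zdUnit d) hπ r hzc hz2
  refine ⟨isProbabilityMeasure_map_centralTwist _ _,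
    isZdTranslationInvariant_map_centralTwist hzc hz2 r ω.translationInvariant hωG,
    permInvariant_map_centralTwist hπ hzc hz2 r ω.permInvariant hωG,
    reflectInvariant_map_centralTwist hπ hzc hz2 r ω.reflectInvariant hωG,
    ω.haarShift.map_centralTwist ρ hs hρ hρz,
    fun i => siteRP_map_centralTwist hπ hzc hz2 r i (ω.siteRP i),
    linkRP_map_centralTwist_last hπ hzc hz2 r (ω.linkRP r),
    fun i F hFm hFb hFS hFG => linkRP_map_centralTwist_of_gaugeInvariant hπ hzc hz2 r i (ω.linkRP i)
      hFm hFb hFS hFG,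
    fun i j hij F hFm hFb hFS hFG => diagRP_map_centralTwist_of_gaugeInvariant hπ hzc hz2 r i j
      (ω.diagRP i j hij) hFm hFb hFS hFG⟩

/-- ★★★ **… yet the twisted state violates FULL diagonal reflection positivity in some plane**
(`β > 0`, `d ≥ 2`, `ρ` non-trivial): it is a translation-invariant one-link Gibbs state at
`-β < 0`, and no such state is diagonally RP in all planes (`ClassBNegativeCouplingAllReps`). With
`twist_summary`: the Class-B obstruction at negative coupling is carried by gauge-VARIANT diagonal
half observables only. -/
theorem _root_.Summit.QuantumFields.GaugeBoot.ClassBState.exists_not_diagRP_twist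
    (hπ : IsDualParity (zdUnit d) π) (hzc : ∀ g : G, z * g = g * z) (hz2 : z * z = 1)
    (hρ : Continuous ρ) (hρz : ρ z = -1) (hρ1 : ∃ g, ((ρ g).trace).re ≠ N) (hd : 2 ≤ d)
    (r : Fin d) {β : ℝ} (hβ : 0 < β) (ω : ClassBState d ρ β)
    (hωG : ∀ k : Site d → G, ω.μ.map (gaugeTransformZd k) = ω.μ) :
    ∃ i j : Fin d, i ≠ j ∧ ¬ IsReflectionPositiveFor (configDiagSwapZd i j) (diagHalfEdges i j)
      (ω.μ.map (centralTwist (stagTwist π r z))) := by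
  obtain ⟨hP, hT, -, -, hH, -⟩ := ω.twist_summary ρ hπ hzc hz2 hρ hρz r hωG
  by_contra h
  push Not at h
  haveI := hP
  exact false_of_translationInvariant_haarShift_diagRP_of_neg_of_ne_one ρ hρ hρ1 hd
    (by linarith : -β < 0) hT hH (fun i j hij => h i j hij)

/-- **Existence of the coordinate parities of `ℤ^d`** (so that the hypotheses `IsDualParity` above
are met): `π_m(x) = x_m mod 2`. -/
theorem exists_isDualParity_zdUnit (d : ℕ) : ∃ π : Fin d → Site d →+ ZMod 2, IsDualParity (zdUnit d) π := by
  refine ⟨fun m => (Int.castAddHom (ZMod 2)).comp (Pi.evalAddMonoidHom (fun _ : Fin d => ℤ) m),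
    fun m k => ?_⟩
  simp only [AddMonoidHom.coe_comp, Function.comp_apply, Pi.evalAddMonoidHom_apply, zdUnit_apply,
    Int.coe_castAddHom]
  by_cases h : m = k
  · subst h; simp
  · simp [h]

end ClassB

end TiltedRP

end Summit.QuantumFields.GaugeBoot
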